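import Summits.BirchSwinnertonDyer.Rank1Residual.X1.LocalReductionStrict
import Summits.BirchSwinnertonDyer.Rank1Residual.X1.StrictClassesIndex
import Summits.BirchSwinnertonDyer.Rank1Residual.X1.LocalTrivialCocyclesCount
import Summits.BirchSwinnertonDyer.Rank1Residual.X1.LocalTwoCharacters
import Literature.NumberTheory.EllipticCurves.LocalEulerCharacteristicTorsion
import Literature.NumberTheory.EllipticCurves.LocalKummerMap
import Literature.NumberTheory.GaloisRepresentations.LocalGlobalCohomologyFiniteProofs
import HarnessLib

/-!
# THE LOCAL PACKAGE at a place `wp ∣ p` of a number field: a subgroup `𝓛 ⊇ 𝓚` of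
# `H¹(K_wp, E[p])` with `p² · #𝓚 ≤ #𝓛` all of whose classes are STRICT
# (cell `b2b-bsdres`, unit `b2b-bsdres-eisenstein-p1`, gen 20; X1R0-GAPMAP §28.4, §29; memo
# `V76-LOCAL-TERM-PLAN.md` §5.2 — (M1-local))

HONEST FRAMING (run/shared/lean/b2b/bsd-rank1-residual/, verbatim in every file): the goal of the
cell is to DELETE the COMBINATION-SHAPED residual classes of the Birch–Swinnerton-Dyer formula for
ALL analytic-rank `≤ 1` elliptic curves over `ℚ` — "full BSD formula for every rank `≤ 1` curve in
class `C`" assembled STRICTLY from published theorems — so that the rank-`≤ 1` remainder becomes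
exactly the CONSTRUCTION-SHAPED classes, which are TYPED (missing-input `Prop`s), NOT attempted.
This is not "finishing BSD". Sub-cell `b2b-bsdres-eisenstein-p1`: research route; NO CLAIM BEYOND
STATED CLASSES; nothing here changes a label; nothing is booked. THEOREMS ONLY — no definition, no
named fact introduced; Tate's local Euler–Poincaré characteristic (`hEP`, Milne I Thm. 2.8, the
tree's named fact) is a HYPOTHESIS, as in `X1/GeneratorCountLayerAtPStrict`; the reduction functional
`s` (values of `red ∘ pointsMap` on `E[p]` in a group `A₀` of order `p`, INVARIANT under the local
Galois group — at an anomalous prime), the `ℤ_p`-valued character `ψ` (restriction of the cyclotomic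
tower character, UNIT on some inertia element, trivial on `res⁻¹(H')`) and the absence of fixed
`p`-th roots of unity are HYPOTHESES, discharged over `ℚ` in the assembly file.

## What and why

`X1/GeneratorCountLayerAtPStrict` (FILE 24b) closes the layer-`n` count of route M given, at the
prime `wp` of `ℚ_n` over `p`, a subgroup `𝓛 ⊇ 𝓚_wp` of `H¹((ℚ_n)_wp, E[p])` with
`p^e · #𝓚_wp ≤ #𝓛` all of whose classes are strict at `p`. This file produces it `K`-GENERALLY
(`K` a number field, `V/K` elliptic, `wp` a finite place, `E[p]` with `p` prime), with `e = 2`: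

* **`exists_strict_addSubgroup`**: there is `𝓛 ≤ H¹(K_wp, E[p])` with
  (i) `𝓚_wp ≤ 𝓛` (`X1/LocalReductionStrict`: Kummer classes are strict),
  (ii) `p² · #𝓚_wp ≤ #𝓛`, and
  (iii) every cocycle `ψc` of every class of `𝓛` has `red(pointsMap(ψc g)) = Õ` for all `g` in the
  local inertia group with `res g ∈ H'`.
  Count (ii): `#H¹ · #{f ∈ Z¹(Γ, A₀) | f(J) = 0} ≤ #𝓛 · #Z¹(Γ, A₀)` (`X1/StrictClassesIndex`),
  `#{f | f(J) = 0} ≥ p²` (`X1/LocalTwoCharacters`), `#Z¹(Γ, A₀) = p · #(𝒪/p)`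
  (`X1/LocalTrivialCocyclesCount`), `#H¹(K_wp, E[p]) = (#E(K_wp)[p] · #(𝒪/p))²` and
  `#𝓚_wp = #E(K_wp)[p] · #(𝒪/p)` (tree, from `hEP`), and `#E(K_wp)[p] ≥ p`.

References: [GreenbergLNM1716] §2 Prop. 2.4, §3 Lemma 3.4 (p. 89), §5 pp. 114–118;
[MilneADT2006] I Thm. 2.8, Cor. 2.3, Lemma 3.3; [SilvermanAEC2009] VII.§2, VIII.§1, X.§4.
-/

noncomputable section

open scoped Classical NNReal

open Function Field NumberField IsDedekindDomain WeierstrassCurve ValuativeRel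
  Literature.NumberTheory.EllipticCurves Literature.NumberTheory.GaloisRepresentations
  IsDedekindDomain.HeightOneSpectrum
open Literature.NumberTheory.GaloisRepresentations.DiscreteGaloisModule (mu MuCarrier)

set_option autoImplicit false

namespace Summit.BirchSwinnertonDyer.Rank1Residual.X1.LocalStrictPackage

open _root_.TopRep _root_.ContinuousCohomology

-- `K : Type` (universe 0), as FILES 6–9 / 23–24c.
variable {K : Type} [Field K] [NumberField K] (V : WeierstrassCurve K) [V.IsElliptic]
  (p : ℕ) [hp : Fact p.Prime] (wp : HeightOneSpectrum (𝓞 K))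
  {w : Valuation (AlgebraicClosure (wp.adicCompletion K)) ℝ≥0}
  (hw : ∀ x, (w x : ℝ) =
    spectralNorm (wp.adicCompletion K) (AlgebraicClosure (wp.adicCompletion K)) x)
  {M : WeierstrassCurve ↥w.valuationSubring}
  (hMK : M.baseChange (AlgebraicClosure (wp.adicCompletion K)) =
    V.baseChange (AlgebraicClosure (wp.adicCompletion K)))
  {red : localPoints V (wp.adicCompletion K) →+
    (M.map (IsLocalRing.residue ↥w.valuationSubring)).toAffine.Point}
  (hred : ∀ P, red P = M.reducePoint (Affine.Point.congrEquiv hMK.symm P))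

/-! ## §1. `#(𝒪[K_wp] ⧸ m) = #(𝓞_wp ⧸ m)` -/

omit hp in
/-- `#(𝒪[K_wp] ⧸ m) = #(𝓞_wp ⧸ m)`: the valuation ring of the local-field structure of `K_wp` is the
ring of `wp`-adic integers (tree `adicCompletion_valuation_le_one_iff`). [folklore] -/
theorem natCard_integer_quotient_natCast_eq (m : ℕ) :
    Nat.card (𝒪[wp.adicCompletion K] ⧸ Ideal.span {((m : ℕ) : 𝒪[wp.adicCompletion K])}) =
      Nat.card (wp.adicCompletionIntegers K ⧸
        Ideal.span {((m : ℕ) : wp.adicCompletionIntegers K)}) := by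
  have hO : (valuation (wp.adicCompletion K)).integer = (wp.adicCompletionIntegers K).toSubring := by
    ext x
    rw [Valuation.mem_integer_iff, adicCompletion_valuation_le_one_iff K wp x,
      ValuationSubring.mem_toSubring, HeightOneSpectrum.mem_adicCompletionIntegers,
      Valued.toNormedField.norm_le_one_iff]
  let e : 𝒪[wp.adicCompletion K] ≃+* wp.adicCompletionIntegers K := RingEquiv.subringCongr hO
  have hIJ : Ideal.span {((m : ℕ) : wp.adicCompletionIntegers K)} =
      (Ideal.span {((m : ℕ) : 𝒪[wp.adicCompletion K])}).map (e : 𝒪[wp.adicCompletion K] →+* _) := by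
    rw [Ideal.map_span, Set.image_singleton, map_natCast]
  exact Nat.card_congr (Ideal.quotientEquiv _ _ e hIJ).toEquiv

/-! ## §2. The local package -/

include hw hred in
/-- **THE LOCAL PACKAGE (M1-local), `K`-generally.** Let `V/K` be elliptic, `p` prime, `wp` a finite
place, `red` the good reduction of an `𝒪_w`-model of `V ⊗ \bar K_wp` (`hred`), `H' ≤ Γ_K`. Suppose:
`A₀` is a group of order `p` and `s : E[p] →+ A₀` detects `red ∘ pointsMap = Õ` (`hs_red`) and is
INVARIANT under `Γ_{K_wp}` (`hs_anom` — at an anomalous prime the local Galois group fixes `Ẽ[p]`);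
`ψ : Γ_{K_wp} → ℤ_p` is continuous, trivial on `res⁻¹(H')`, with a UNIT value on some inertia
element; `\bar K_wp` has no `Γ_{K_wp}`-fixed primitive `p`-th root of unity; `#E(K_wp)[p] ≥ p`; and
Tate's local Euler–Poincaré characteristic holds at `K_wp` (`hEP`). Then there is a subgroup
`𝓛 ≤ H¹(K_wp, E[p])` with `𝓚_wp ≤ 𝓛`, `p² · #𝓚_wp ≤ #𝓛`, and every cocycle of every class of `𝓛`
has `red(pointsMap(ψc g)) = Õ` for all `g ∈ I_{K_wp}` with `res g ∈ H'`.
[cite: GreenbergLNM1716, §3 Lemma 3.4 (p. 89), §5 pp. 114–118] [cite: MilneADT2006, I Thm. 2.8] -/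
theorem exists_strict_addSubgroup (H' : Subgroup (absoluteGaloisGroup K))
    (A₀ : Type) [AddCommGroup A₀] [Finite A₀] (hA₀ : Nat.card A₀ = p)
    (s : geomTorsion V (p : ℤ) →+ A₀)
    (hs_red : ∀ Q : geomTorsion V (p : ℤ), s Q = 0 ↔
      red (pointsMap V (wp.adicCompletion K) ((Q : geomTorsion V (p : ℤ)) : geomPoints V)) = 0)
    (hs_anom : ∀ (g : absoluteGaloisGroup (wp.adicCompletion K)) (Q : geomTorsion V (p : ℤ)),
      s (absGaloisRestrict K (wp.adicCompletion K) g • Q) = s Q)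
    (ψ : absoluteGaloisGroup (wp.adicCompletion K) →ₜ* Multiplicative ℤ_[p])
    (hI : ∃ g ∈ absInertia (wp.adicCompletion K), ¬ (p : ℤ_[p]) ∣ (ψ g).toAdd)
    (hψH' : ∀ g : absoluteGaloisGroup (wp.adicCompletion K),
      absGaloisRestrict K (wp.adicCompletion K) g ∈ H' → ψ g = 1)
    (hEP : localEulerPoincareCharacteristic (wp.adicCompletion K))
    (hμ : ∀ ζ : MuCarrier (wp.adicCompletion K) (p ^ 1),
      (∀ σ : absoluteGaloisGroup (wp.adicCompletion K), mu (wp.adicCompletion K) (p ^ 1) σ ζ = ζ) →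
        ζ = 0)
    (ht : p ≤ Nat.card (nsmulAddMonoidHom p :
      (V.baseChange (wp.adicCompletion K)).toAffine.Point →+ _).ker) :
    ∃ 𝓛 : AddSubgroup (galoisCohomology
        (GaloisRep.restrictField (wp.adicCompletion K) (V.torsionGaloisModule (p : ℤ))) 1),
      V.kummerLocalConditionAt (p : ℤ) (wp.adicCompletion K) ≤ 𝓛 ∧
      p ^ 2 * Nat.card (V.kummerLocalConditionAt (p : ℤ) (wp.adicCompletion K)) ≤ Nat.card 𝓛 ∧
      ∀ c ∈ 𝓛, ∀ ψc : contOneCocycles (DiscreteGaloisModule.toTopRep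
          (GaloisRep.restrictField (wp.adicCompletion K) (V.torsionGaloisModule (p : ℤ)))),
        oneCocycleClass _ ψc = c →
        ∀ g : absoluteGaloisGroup (wp.adicCompletion K), g ∈ absInertia (wp.adicCompletion K) →
          absGaloisRestrict K (wp.adicCompletion K) g ∈ H' →
          red (pointsMap V (wp.adicCompletion K) ((ψc.1 g : geomTorsion V (p : ℤ)) : geomPoints V))
            = 0 := by
  -- notation and instances
  letI : TopologicalSpace A₀ := ⊥
  haveI : DiscreteTopology A₀ := ⟨rfl⟩
  haveI : CharZero (wp.adicCompletion K) := charZero_adicCompletion wp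
  haveI : NeZero p := ⟨hp.out.ne_zero⟩
  haveI : NeZero (p : ℤ) := ⟨by exact_mod_cast hp.out.ne_zero⟩
  haveI : Finite (geomTorsion V (p : ℤ)) := finite_geomTorsion_of_neZero V p
  set Lw := wp.adicCompletion K
  set X := DiscreteGaloisModule.toTopRep
    (GaloisRep.restrictField Lw (V.torsionGaloisModule (p : ℤ))) with hX
  haveI hHfin : Finite (galoisCohomology
      (GaloisRep.restrictField Lw (V.torsionGaloisModule (p : ℤ))) 1) :=
    finite_galoisCohomology_one_adicCompletion wp _
  haveI : Finite (continuousCohomology 1 X) := hHfin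
  have hpA : ∀ a : A₀, p ^ 1 • a = 0 := fun a ↦ by
    rw [pow_one, ← hA₀]; exact card_nsmul_eq_zero'
  -- `#Z¹(Γ, A₀) = p · #(𝒪/p)` and finiteness
  obtain ⟨hZfin, hZ⟩ :=
    LocalTrivialCocyclesCount.natCard_contOneCocycles_trivial_eq_of_forall_mu Lw A₀ hEP hpA hμ
  haveI := hZfin
  -- the strict subgroup of `X1/StrictClassesIndex`
  let J : Subgroup (absoluteGaloisGroup Lw) :=
    absInertia Lw ⊓ H'.comap (absGaloisRestrict K Lw).toMonoidHom
  have hJ : ∀ g, g ∈ J ↔ g ∈ absInertia Lw ∧ absGaloisRestrict K Lw g ∈ H' := fun g ↦ by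
    rw [Subgroup.mem_inf, Subgroup.mem_comap]; rfl
  have hsX : ∀ (g : absoluteGaloisGroup Lw) (x : X), s (X.ρ g x) = s x := fun g x ↦ hs_anom g x
  obtain ⟨𝓛, hiff, hcount⟩ := StrictClassesIndex.exists_addSubgroup_strict X s
    continuous_of_discreteTopology hsX J
  -- `#{f | f(J) = 0} ≥ p²`
  have hKJ : p ^ 2 ≤ Nat.card {f : contOneCocycles
      (ContinuousRep.trivial (absoluteGaloisGroup Lw) ℤ A₀).toTopRep // ∀ g ∈ J, f.1 g = 0} :=
    LocalTwoCharacters.sq_le_natCard_subtype_of_unit_on_inertia Lw A₀ hA₀ ψ hI J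
      (fun g hg ↦ ((hJ g).mp hg).1) (fun g hg ↦ hψH' g ((hJ g).mp hg).2)
  -- cardinalities from `hEP`
  have hH : Nat.card (galoisCohomology
      (GaloisRep.restrictField Lw (V.torsionGaloisModule (p : ℤ))) 1) =
      (Nat.card (nsmulAddMonoidHom p : (V.baseChange Lw).toAffine.Point →+ _).ker *
        Nat.card (wp.adicCompletionIntegers K ⧸ Ideal.span {(p : wp.adicCompletionIntegers K)})) ^ 2 :=
    natCard_galoisCohomology_one_torsion_adicCompletion_eq_sq V wp p (hp.out.isPrimePow) hEP
  have hKum : Nat.card (V.kummerLocalConditionAt (p : ℤ) Lw) =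
      Nat.card (nsmulAddMonoidHom p : (V.baseChange Lw).toAffine.Point →+ _).ker *
        Nat.card (wp.adicCompletionIntegers K ⧸ Ideal.span {(p : wp.adicCompletionIntegers K)}) :=
    V.natCard_kummerLocalConditionAt_adicCompletion wp hp.out.ne_zero
  have hZ' : Nat.card (contOneCocycles (ContinuousRep.trivial (absoluteGaloisGroup Lw) ℤ A₀).toTopRep) =
      p * Nat.card (wp.adicCompletionIntegers K ⧸ Ideal.span {(p : wp.adicCompletionIntegers K)}) := by
    rw [hZ, hA₀, natCard_integer_quotient_natCast_eq]
  -- positivity of `N = #(𝒪/p)`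
  haveI : Finite (V.kummerLocalConditionAt (p : ℤ) Lw) :=
    V.finite_kummerLocalConditionAt_adicCompletion wp hp.out.ne_zero
  have hKpos : 0 < Nat.card (V.kummerLocalConditionAt (p : ℤ) Lw) := Nat.card_pos
  set t := Nat.card (nsmulAddMonoidHom p : (V.baseChange Lw).toAffine.Point →+ _).ker with htdef
  set N := Nat.card (wp.adicCompletionIntegers K ⧸ Ideal.span {(p : wp.adicCompletionIntegers K)})
    with hNdef
  have hNpos : 0 < N := by
    rcases Nat.eq_zero_or_pos N with h0 | h0
    · rw [hKum, h0, mul_zero] at hKpos; exact absurd hKpos (lt_irrefl 0)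
    · exact h0
  refine ⟨𝓛, fun c hc ↦ ?_, ?_, fun c hc ψc hψc g hgI hgH' ↦ ?_⟩
  · -- (i) Kummer classes are strict
    refine (hiff c).mpr fun ψc hψc g hg ↦ ?_
    rw [hs_red]
    refine LocalReductionStrict.forall_red_cocycle_eq_zero_of_mem_kummerLocalConditionAt V (p : ℤ)
      wp hw hMK hred ψc ?_ ((hJ g).mp hg).1
    rw [hψc]; exact hc
  · -- (ii) the index
    have h1 : Nat.card (galoisCohomology
        (GaloisRep.restrictField Lw (V.torsionGaloisModule (p : ℤ))) 1) * p ^ 2 ≤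
        Nat.card 𝓛 * (p * N) := by
      calc _ ≤ Nat.card (galoisCohomology
              (GaloisRep.restrictField Lw (V.torsionGaloisModule (p : ℤ))) 1) *
            Nat.card {f : contOneCocycles
              (ContinuousRep.trivial (absoluteGaloisGroup Lw) ℤ A₀).toTopRep // ∀ g ∈ J, f.1 g = 0} :=
            Nat.mul_le_mul_left _ hKJ
        _ ≤ _ := by rw [← hZ']; exact hcount
    rw [hH] at h1
    rw [hKum]
    -- `(tN)² p² ≤ #𝓛 · pN` and `p ≤ t` give `p² t N ≤ #𝓛`
    have h2 : p ^ 2 * (t * N) * (p * N) ≤ Nat.card 𝓛 * (p * N) :=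
      calc p ^ 2 * (t * N) * (p * N) = p * (t * N) * (p * N) * p := by ring
        _ ≤ p * (t * N) * (p * N) * t := Nat.mul_le_mul_left _ ht
        _ = (t * N) ^ 2 * p ^ 2 := by ring
        _ ≤ Nat.card 𝓛 * (p * N) := h1
    exact Nat.le_of_mul_le_mul_right h2 (Nat.mul_pos hp.out.pos hNpos)
  · -- (iii) strictness in terms of `red`
    exact (hs_red _).mp ((hiff c).mp hc ψc hψc g ((hJ g).mpr ⟨hgI, hgH'⟩))

end Summit.BirchSwinnertonDyer.Rank1Residual.X1.LocalStrictPackage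

end
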